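import Mathlib
import HarnessLib

/-!
# Siegel's lemma with a prescribed Dirichlet exponent (CDT §2.1)

`Literature/NumberTheory/DiophantineApproximation/SiegelLemmaMargin.lean`. Everything here is
PROVED (no definition, no named fact). Mathlib's Siegel lemma
(`Int.Matrix.exists_ne_zero_int_vec_norm_le`: a nonzero integer solution of `A t = 0` with
`‖t‖ ≤ (n · max 1 ‖A‖)^{m/(n−m)}` for an `m × n` integer matrix `A`, `m < n`) in the form used by
F. Calegari, V. Dimitrov, Y. Tang, *The unbounded denominators conjecture* (J. Amer. Math. Soc.
**38** (2025), 627–702; arXiv:2109.09040), §2.1, proof of Lemma 2.1.1: "The result then follows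
from the classical Siegel lemma [Bombieri–Gubler, Lemma 2.9.1], with `e^C := M/ρ` and the degree
parameter choice `D ∼ (1/m) (d!)^{-1/d} (1 + 1/κ)^{1/d} α`, that brings in a Dirichlet exponent
`∼ κ` as `α → ∞`" (there are `(mD)ᵈ` unknowns `a_{i,k}` and `∼ αᵈ/d!` equations, so this choice
of `D` makes the number of unknowns `∼ (1 + 1/κ)` times the number of equations). Precisely:
if the number `n` of unknowns is at least `(1 + 1/κ)` times the number `m ≥ 1` of equations, then
`m/(n − m) ≤ κ` and there is a nonzero integer solution with `‖t‖ ≤ (n · max 1 ‖A‖)^κ`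
(`exists_ne_zero_int_vec_norm_le_rpow`), i.e. `log ‖t‖ ≤ κ (log n + log⁺ ‖A‖)`
(`exists_ne_zero_int_vec_log_norm_le`).

## References

* [CalegariDimitrovTang2025] F. Calegari, V. Dimitrov, Y. Tang, The unbounded denominators
  conjecture, J. Amer. Math. Soc. 38 (2025), no. 3, 627–702, §2.1, proof of Lemma 2.1.1;
  arXiv:2109.09040.
* E. Bombieri, W. Gubler, Heights in Diophantine geometry, CUP 2006, Lemma 2.9.1 (Siegel's lemma,
  the form in Mathlib).
-/

noncomputable section

namespace Literature.NumberTheory.DiophantineApproximation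

open Matrix Finset Real

variable {α β : Type*} [Fintype α] [Fintype β]

/-- The Dirichlet exponent: if `n ≥ (1 + 1/κ) m` with `m > 0`, then `m < n` and
`m / (n − m) ≤ κ`. [cite: CalegariDimitrovTang2025, §2.1, proof of Lemma 2.1.1] -/
theorem div_sub_le_of_le_card {κ : ℝ} (hκ : 0 < κ) {m n : ℕ} (hm : 0 < m)
    (hmn : (1 + κ⁻¹) * m ≤ n) : m < n ∧ (m : ℝ) / (n - m) ≤ κ := by
  have hm' : (0 : ℝ) < m := by exact_mod_cast hm
  have h1 : (m : ℝ) + κ⁻¹ * m ≤ n := by linarith [hmn, add_mul 1 κ⁻¹ (m : ℝ)]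
  have h2 : (0 : ℝ) < κ⁻¹ * m := mul_pos (inv_pos.mpr hκ) hm'
  have hlt : (m : ℝ) < n := by linarith
  refine ⟨by exact_mod_cast hlt, ?_⟩
  rw [div_le_iff₀ (by linarith)]
  -- `m ≤ κ (n − m)` from `κ⁻¹ m ≤ n − m`
  have h3 : κ⁻¹ * m ≤ (n : ℝ) - m := by linarith
  have h4 := mul_le_mul_of_nonneg_left h3 hκ.le
  rw [← mul_assoc, mul_inv_cancel₀ hκ.ne', one_mul] at h4
  linarith [h4]

/-- **Siegel's lemma with Dirichlet exponent `κ`** (CDT §2.1): for an `m × n` integer matrix `A`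
with `m ≥ 1` rows (equations) and `n ≥ (1 + 1/κ) m` columns (unknowns), the system `A t = 0` has
a nonzero integer solution with `‖t‖ ≤ (n · max 1 ‖A‖)^κ` (sup norms; the sup norm of the
matrix `A` is that of the underlying function `Matrix.of.symm A : α → β → ℤ`, which is the norm
`Matrix.seminormedAddCommGroup` used in Mathlib's Siegel lemma).
[cite: CalegariDimitrovTang2025, §2.1, proof of Lemma 2.1.1] -/
theorem exists_ne_zero_int_vec_norm_le_rpow (A : Matrix α β ℤ) {κ : ℝ} (hκ : 0 < κ)
    (hm : 0 < Fintype.card α) (hmn : (1 + κ⁻¹) * Fintype.card α ≤ Fintype.card β) :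
    ∃ t : β → ℤ, t ≠ 0 ∧ A *ᵥ t = 0 ∧
      ‖t‖ ≤ ((Fintype.card β : ℝ) * max 1 ‖Matrix.of.symm A‖) ^ κ := by
  obtain ⟨hlt, hexp⟩ := div_sub_le_of_le_card hκ hm hmn
  obtain ⟨t, ht0, hAt, hnorm⟩ :=
    @Int.Matrix.exists_ne_zero_int_vec_norm_le α β _ _ A hlt hm
  have hnorm' : ‖t‖ ≤ ((Fintype.card β : ℝ) * max 1 ‖Matrix.of.symm A‖) ^
      ((Fintype.card α : ℝ) / (Fintype.card β - Fintype.card α)) := hnorm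
  refine ⟨t, ht0, hAt, hnorm'.trans ?_⟩
  refine Real.rpow_le_rpow_of_exponent_le ?_ hexp
  have hn1 : (1 : ℝ) ≤ Fintype.card β := by exact_mod_cast Nat.one_le_of_lt (hm.trans hlt)
  calc (1 : ℝ) = 1 * 1 := (mul_one 1).symm
    _ ≤ (Fintype.card β : ℝ) * max 1 ‖Matrix.of.symm A‖ :=
        mul_le_mul hn1 (le_max_left _ _) zero_le_one (by positivity)

/-- Logarithmic form: `log ‖t‖ ≤ κ (log n + log⁺ ‖A‖)`. [cite: CalegariDimitrovTang2025, §2.1,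
proof of Lemma 2.1.1] -/
theorem exists_ne_zero_int_vec_log_norm_le (A : Matrix α β ℤ) {κ : ℝ} (hκ : 0 < κ)
    (hm : 0 < Fintype.card α) (hmn : (1 + κ⁻¹) * Fintype.card α ≤ Fintype.card β) :
    ∃ t : β → ℤ, t ≠ 0 ∧ A *ᵥ t = 0 ∧
      Real.log ‖t‖ ≤ κ * (Real.log (Fintype.card β) + log⁺ ‖Matrix.of.symm A‖) := by
  obtain ⟨t, ht0, hAt, hnorm⟩ := exists_ne_zero_int_vec_norm_le_rpow A hκ hm hmn
  refine ⟨t, ht0, hAt, ?_⟩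
  have hlt : Fintype.card α < Fintype.card β := (div_sub_le_of_le_card hκ hm hmn).1
  have hn0 : (0 : ℝ) < Fintype.card β := by exact_mod_cast hm.trans hlt
  have hbase : (0 : ℝ) < (Fintype.card β : ℝ) * max 1 ‖Matrix.of.symm A‖ := by positivity
  -- `‖t‖ ≥ 1` for a nonzero integer vector, so `log ‖t‖ ≤ log ((n max 1 ‖A‖)^κ)`
  have ht1 : (1 : ℝ) ≤ ‖t‖ := by
    obtain ⟨j, hj⟩ := Function.ne_iff.mp ht0
    calc (1 : ℝ) ≤ ‖t j‖ := by
          rw [Int.norm_eq_abs]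
          exact_mod_cast Int.one_le_abs hj
      _ ≤ ‖t‖ := norm_le_pi_norm t j
  calc Real.log ‖t‖ ≤ Real.log (((Fintype.card β : ℝ) * max 1 ‖Matrix.of.symm A‖) ^ κ) :=
        Real.log_le_log (by linarith) hnorm
    _ = κ * (Real.log (Fintype.card β) + log⁺ ‖Matrix.of.symm A‖) := by
        rw [Real.log_rpow hbase, Real.log_mul hn0.ne' (by positivity)]
        congr 2
        rcases le_or_gt ‖Matrix.of.symm A‖ 1 with hA | hA
        · rw [max_eq_left hA, Real.log_one, (Real.posLog_eq_zero_iff _).mpr]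
          rw [abs_of_nonneg (norm_nonneg _)]; exact hA
        · have hA' : (1 : ℝ) ≤ |‖Matrix.of.symm A‖| := by
            rw [abs_of_nonneg (norm_nonneg _)]; exact hA.le
          rw [max_eq_right hA.le, Real.posLog_eq_log hA']

end Literature.NumberTheory.DiophantineApproximation
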